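import Summits.QuantumAdvantage.QuantumAdvantage.Theorems.WbwObfuscatedGluedTreesKowBpsDistinguisher
import Literature.Computability.Cryptography.IndistinguishabilityObfuscatorSubexp
import Summits.QuantumAdvantage.QuantumAdvantage.Theorems.WbwObfuscatedGluedTrees.Negative.KeyedIndistinguishability

/-!
# `WbwObfuscatedGluedTrees` (stmt-QuantumAdvantage-2340) — line `knowledge-of-walk-split`, stub `stub_bestPossibleStep` II: the keyed iO step

The keyed hybrid of the best-possible step: for key-indexed families `C₀ k ≡ C₁ k` of admissible pairs
(same arity, size and function, both in `ppolyCircuits (κ n)`), advice `⟨1ⁿ, ⟨nm k, ans k⟩⟩` of polynomial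
length, and a schedule `κ n ≥ n^c`, the advised iO advantage of the distinguisher `dist A₁ B` (file I) between
`O(κ n, C₀ k)` and `O(κ n, C₁ k)` is at most `2^{-(κ n)^ε}` for all sufficiently large `n`, SIMULTANEOUSLY for
all keys `k ∈ {0,1}^{h n}` — by the landed worst-case-key lemma
`Negative.KeyedIndistinguishability.keyed_family_subexp` applied to the finite key sets
`keys κ₀ = {(n, k) | N₀ ≤ n < κ₀^D + 2, κ n = κ₀, |k| = h n}` (`D = ⌈1/c⌉`).
-/

set_option linter.dupNamespace false

namespace Summit.QuantumAdvantage.QuantumAdvantage.Theorems.WbwObfuscatedGluedTrees.KnowledgeOfWalk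

open Literature.Computability.Cryptography Literature.Computability.Complexity
open _root_.Computability Polynomial Filter Asymptotics
open Summit.QuantumAdvantage.QuantumAdvantage.Theorems.WbwObfuscatedGluedTrees.Negative

namespace BestPossibleStep

/-! ### Finite key sets -/

/-- All bit strings of length `a`, as a `Finset`. [folklore] -/
noncomputable def strings (a : ℕ) : Finset (List Bool) :=
  (Finset.univ : Finset (List.Vector Bool a)).image List.Vector.toList

/-- Membership in `strings a` is having length `a`. [folklore] -/
@[simp] theorem mem_strings {a : ℕ} {k : List Bool} : k ∈ strings a ↔ k.length = a := by
  constructor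
  · intro h
    obtain ⟨v, -, rfl⟩ := Finset.mem_image.1 h
    exact v.toList_length
  · intro h
    exact Finset.mem_image.2 ⟨⟨k, h⟩, Finset.mem_univ _, rfl⟩

/-- **The key set at security parameter `κ₀`**: pairs `(n, k)` with `N₀ ≤ n < κ₀^D + 2`, `κ n = κ₀` and
`k ∈ {0,1}^{h n}` (finite). [folklore] -/
noncomputable def keys (κ h : ℕ → ℕ) (N₀ D κ₀ : ℕ) : Finset (ℕ × List Bool) :=
  ((Finset.range (κ₀ ^ D + 2)).filter (fun n => N₀ ≤ n ∧ κ n = κ₀)).biUnion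
    (fun n => (strings (h n)).image (fun k => (n, k)))

/-- Membership in the key set. [folklore] -/
theorem mem_keys {κ h : ℕ → ℕ} {N₀ D κ₀ n : ℕ} {k : List Bool} :
    (n, k) ∈ keys κ h N₀ D κ₀ ↔ n < κ₀ ^ D + 2 ∧ N₀ ≤ n ∧ κ n = κ₀ ∧ k.length = h n := by
  simp only [keys, Finset.mem_biUnion, Finset.mem_filter, Finset.mem_range, Finset.mem_image, mem_strings,
    Prod.mk.injEq]
  constructor
  · rintro ⟨n', ⟨hn', hN, hκ⟩, k', hk', rfl, rfl⟩
    exact ⟨hn', hN, hκ, hk'⟩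
  · rintro ⟨hn, hN, hκ, hk⟩
    exact ⟨n, ⟨hn, hN, hκ⟩, k, hk, rfl, rfl⟩

/-! ### Real-analysis bookkeeping for the schedule `n^c ≤ κ n` -/

/-- If `n^c ≤ K` (`0 < c`, `D ≥ 1/c`) then `n < K^D + 2`. [folklore] -/
theorem lt_pow_add_two_of_rpow_le {c : ℝ} (hc : 0 < c) {D : ℕ} (hD : 1 / c ≤ D) {n K : ℕ}
    (h : (n : ℝ) ^ c ≤ K) : n < K ^ D + 2 := by
  rcases Nat.eq_zero_or_pos K with hK | hK
  · subst hK
    have hn : (n : ℝ) ^ c ≤ 0 := by simpa using h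
    have hn0 : (n : ℝ) = 0 := by
      by_contra hne
      have hpos : 0 < (n : ℝ) := lt_of_le_of_ne (Nat.cast_nonneg n) (Ne.symm hne)
      exact absurd hn (not_le.2 (Real.rpow_pos_of_pos hpos c))
    have : n = 0 := by exact_mod_cast hn0
    subst this
    simp
  · have hK1 : (1 : ℝ) ≤ K := by exact_mod_cast hK
    have h1 : (n : ℝ) ≤ (K : ℝ) ^ (1 / c) := by
      have := Real.rpow_le_rpow (by positivity) h (le_of_lt (one_div_pos.2 hc))
      rwa [← Real.rpow_mul (Nat.cast_nonneg n), mul_one_div_cancel hc.ne', Real.rpow_one] at this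
    have h2 : (K : ℝ) ^ (1 / c) ≤ (K : ℝ) ^ (D : ℝ) := Real.rpow_le_rpow_of_exponent_le hK1 hD
    have h3 : (n : ℝ) ≤ (K : ℝ) ^ D := by rw [← Real.rpow_natCast]; exact h1.trans h2
    have h4 : n ≤ K ^ D := by exact_mod_cast h3
    omega

/-! ### The keyed step -/

variable {A₁ : RandAlg (List Bool) (List Bool)} {B : Polynomial ℕ}

/-- **Keyed iO step (eventual, uniform in the key).**  Under a sub-exponentially secure iO `O` on
`ppolyCircuits`, for key-indexed admissible pairs at security parameter `κ n ≥ n^c` with advice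
`⟨1ⁿ, ⟨nm k, ans k⟩⟩` of polynomial length, the advised iO advantage of `dist A₁ B` between `O(κ n, C₀ k)` and
`O(κ n, C₁ k)` is `≤ 2^{-(κ n)^ε}` for all large `n` and all keys `k ∈ {0,1}^{h n}` at once.
[cite: BitanskyPanethRosen2015, Def. 4.1] -/
theorem eventually_ioAdvantageAdv_le {ε : ℝ} {O : CircuitObfuscator} (hε : 0 < ε)
    (hO : IsSubexpIO ε ppolyCircuits O) (κ h : ℕ → ℕ) (m : List Bool → ℕ)
    (C₀ C₁ : (k : List Bool) → Circuit (Fin (m k))) (nm ans : List Bool → List Bool)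
    (hκlo : ∃ c : ℝ, 0 < c ∧ ∀ᶠ n : ℕ in atTop, (n : ℝ) ^ c ≤ κ n)
    (hadvlen : ∃ q : Polynomial ℕ, ∀ (n : ℕ) (k : List Bool), k.length = h n →
      (nm k).length + (ans k).length ≤ q.eval n)
    (hpair : ∀ (n : ℕ) (k : List Bool), k.length = h n →
      (⟨m k, C₀ k⟩ : SizedCircuit) ∈ ppolyCircuits (κ n) ∧ (⟨m k, C₁ k⟩ : SizedCircuit) ∈ ppolyCircuits (κ n) ∧
        (C₀ k).size = (C₁ k).size ∧ (∀ x, (C₀ k).eval x = (C₁ k).eval x))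
    (hA₁ : IsPPT A₁ id) (B : Polynomial ℕ) :
    ∀ᶠ n : ℕ in atTop, ∀ k : List Bool, k.length = h n →
      O.ioAdvantageAdv (dist A₁ B) (fun _ => boolPair (unaryEncodeNat n) (boolPair (nm k) (ans k))) (κ n)
        (C₀ k) (C₁ k) ≤ (2 : ℝ) ^ (-((κ n : ℝ) ^ ε)) := by
  obtain ⟨c, hc, hev⟩ := hκlo
  obtain ⟨N₀, hN₀⟩ := eventually_atTop.1 hev
  obtain ⟨q, hq⟩ := hadvlen
  set D : ℕ := ⌈1 / c⌉₊ with hD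
  have hDc : 1 / c ≤ D := Nat.le_ceil _
  -- advice and its length bound
  let adv : ℕ → ℕ × List Bool → List Bool := fun _ nk =>
    boolPair (unaryEncodeNat nk.1) (boolPair (nm nk.2) (ans nk.2))
  let Padv : Polynomial ℕ := (2 * X + 4 + 2 * q).comp (X ^ D + 2)
  have hadv : ∀ᶠ κ₀ : ℕ in atTop, ∀ nk ∈ keys κ h N₀ D κ₀,
      ((adv κ₀ nk).length : ℝ) ≤ (2 : ℝ) ^ ((κ₀ : ℝ) ^ ε) := by
    filter_upwards [eventually_natPoly_le_two_rpow Padv hε] with κ₀ hκ₀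
    rintro ⟨n, k⟩ hnk
    obtain ⟨hn, -, -, hk⟩ := mem_keys.1 hnk
    refine le_trans ?_ hκ₀
    have h1 : (adv κ₀ (n, k)).length ≤ (2 * X + 4 + 2 * q : Polynomial ℕ).eval n := by
      have := hq n k hk
      simp only [adv, length_boolPair, length_unaryEncodeNat, eval_add, eval_mul, eval_ofNat, eval_X]
      omega
    have h2 : (2 * X + 4 + 2 * q : Polynomial ℕ).eval n ≤ Padv.eval κ₀ := by
      simp only [Padv, eval_comp]
      refine SeedLaw.natPoly_eval_mono _ ?_
      simp only [eval_add, eval_pow, eval_X, eval_ofNat]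
      exact hn.le
    exact_mod_cast h1.trans h2
  -- the keyed family
  have hkey := KeyedIndistinguishability.keyed_family_subexp hO (dist A₁ B) (isPPT_dist hA₁ B)
    (keys κ h N₀ D) adv hadv (fun _ nk => m nk.2) (fun _ nk => C₀ nk.2) (fun _ nk => C₁ nk.2)
    (fun κ₀ nk hnk => by
      obtain ⟨-, -, hκ, hk⟩ := mem_keys.1 (show (nk.1, nk.2) ∈ _ from hnk)
      rw [← hκ]; exact (hpair nk.1 nk.2 hk).1)
    (fun κ₀ nk hnk => by
      obtain ⟨-, -, hκ, hk⟩ := mem_keys.1 (show (nk.1, nk.2) ∈ _ from hnk)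
      rw [← hκ]; exact (hpair nk.1 nk.2 hk).2.1)
    (fun κ₀ nk hnk => by
      obtain ⟨-, -, -, hk⟩ := mem_keys.1 (show (nk.1, nk.2) ∈ _ from hnk)
      exact (hpair nk.1 nk.2 hk).2.2.1)
    (fun κ₀ nk hnk => by
      obtain ⟨-, -, -, hk⟩ := mem_keys.1 (show (nk.1, nk.2) ∈ _ from hnk)
      exact (hpair nk.1 nk.2 hk).2.2.2)
  obtain ⟨K₁, hK₁⟩ := eventually_atTop.1 hkey
  -- transfer "eventually in κ₀" to "eventually in n" along κ n ≥ n^c → ∞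
  have hκ_large : ∀ᶠ n : ℕ in atTop, K₁ ≤ κ n := by
    have ht : Tendsto (fun n : ℕ => (n : ℝ) ^ c) atTop atTop :=
      (tendsto_rpow_atTop hc).comp tendsto_natCast_atTop_atTop
    filter_upwards [ht.eventually_ge_atTop (K₁ : ℝ), hev] with n h1 h2
    exact_mod_cast h1.trans h2
  filter_upwards [hκ_large, eventually_ge_atTop N₀] with n hn1 hn2 k hk
  have hmem : (n, k) ∈ keys κ h N₀ D (κ n) :=
    mem_keys.2 ⟨lt_pow_add_two_of_rpow_le hc hDc (hN₀ n hn2), hn2, rfl, hk⟩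
  exact hK₁ (κ n) hn1 (n, k) hmem

end BestPossibleStep

/-- Registered helper stub of crux stmt-QuantumAdvantage-2340 (closed form of `BestPossibleStep.lt_pow_add_two_of_rpow_le`, the schedule bookkeeping of the keyed iO step). [folklore] -/
theorem toolkit_bpsKeyedStep :
    ∀ (c : ℝ), 0 < c → ∀ (D : ℕ), 1 / c ≤ D → ∀ (n K : ℕ), (n : ℝ) ^ c ≤ K → n < K ^ D + 2 :=
  fun _ hc _ hD _ _ h => BestPossibleStep.lt_pow_add_two_of_rpow_le hc hD h

end Summit.QuantumAdvantage.QuantumAdvantage.Theorems.WbwObfuscatedGluedTrees.KnowledgeOfWalk
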